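/-
Copyright (c) 2026 the pub-hodgecm-mathlib formalisation cell (harness21).  Prover seat hodgecm-mathlib-K2E4-p14 (g9), Track B ∕ K2-LIT, h413 = `stmt-HodgeConjecture-24833`,
route of record `HCCMUnconditional`, ROADCARD «5Res ENDGAME BY FAMILIES» §2 C7 → §3′ (EXH); dealer K2E1-plan (g7) deals (260)∕(261): the `Eis`∕`hEXH` letters of ★
`K2E1ResidualPartInAtomsCMTwo.hatoms_of_letters` from the C7 block adapter WITHOUT any orthogonality between blocks (ruling (261), FLAG A).
-/
import Summits.HodgeConjecture.HodgeConjecture.Theorems.K2E1CuspidalSpectrumUnitaryDefs   -- ★ `AdelicGroupData.L2` (for the `𝒢`-print only)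
import Mathlib.Analysis.InnerProductSpace.Projection.Basic
import HarnessLib

/-!
# h413 ∕ Track B «K2-LIT», 5Res §3′ (EXH) — `K2E1ResidualEisExhaustionCMTwo`: BLOCKS EXHAUSTING `Eis` + BLOCKWISE-INJECTIVE COORDINATES ⟹ JOINT INJECTIVITY ON `Eis`, WITH NO
# ORTHOGONALITY AND NO FINITENESS OF THE BLOCK FAMILY (the `hEXH` letter of ★ `hatoms_of_letters` in the C7 adapter's shape)

Cell `pub/hodgecm-mathlib`, crux H413 = `stmt-HodgeConjecture-24833`; dealer K2E1-plan (g7) (260), ruling (261).  THEOREMS ONLY (no `def`, no `instance`, no `notation`, no named-fact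
hypothesis, no `sorry`); lane `--kind proof --supports stmt-HodgeConjecture-24833 --as helper` (count-neutral, closes no socket).

THE MATHEMATICS (ruling (261); [MoeglinWaldspurger1995, II.1.4, II.2.4, V.3.13]; [ReedSimonI1980, Thm. II.3]).  Let `Blk b ≤ H` be subspaces with orthogonal projections `P_b`,
`Eis ≤ closure ⨆_b Blk b`, and `V b` linear, injective on `Blk b`.  If `x ∈ Eis` and `V b (P_b x) = 0` for all `b`, then `P_b x = 0`, i.e. `x ∈ (Blk b)ᗮ` for all `b`, so
`x ∈ ⨅_b (Blk b)ᗮ = (⨆_b Blk b)ᗮ = (closure ⨆_b Blk b)ᗮ ∋⊥ x`: `⟪x, x⟫ = 0`, `x = 0`.  No orthogonality BETWEEN the blocks and no finiteness of the index are used (★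
`K2E1FamilyExhaustionInjectiveU.hEXH_of_orthogonalBlocks` asked both): associate families `χ, χʷ ∈ S(K′)` may index overlapping blocks harmlessly, and the (XF) cross-Gram stays banked.
* §1 **`exhaustion_injective_of_blocks`** (abstract Hilbert space) — ★ `exhaustion_injective` minus `horth` and minus `[Fintype β]`.
* §2 **`hEXH_of_blocks`** — the `𝒢`-print on `L²(G(F)∖G(𝔸), μ)` with atom × line targets `A b × L b`: the `hEXH` binder of ★ `hatoms_of_letters` ∕ ★ `hatoms_of_noLineMass` VERBATIM at
  `U b := V b ∘ P_{Blk b}`.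
* §3 **`hEXH_of_generators`** — the same at the C7 adapter's shape (★ `K2E1EisensteinBlocksFintypeAdapterU2.exists_finite_blocks`): blocks `closure span (gen s)` indexed by `s ∈ S`
  (= `↥S(K′)`), `hEis : Eis ≤ closure ⨆_s closure span (gen s)` VERBATIM, `V s` injective on `closure span (gen s)` (the D4′ model maps ★ `modelMap`).
HONEST LABEL: HC_CM is proved only modulo the 7 printed citations (2 remaining named inputs: hLiu418 = `stmt-HodgeConjecture-24832`, h413 = `stmt-HodgeConjecture-24833`) until rung 0
closes; count-neutral helper, asserts no named fact, closes no socket.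

## References
* [MoeglinWaldspurger1995] C. Mœglin, J.-L. Waldspurger, *Spectral Decomposition and Eisenstein Series* (1995), II.1.4, II.2.4, V.3.13.
* [ReedSimonI1980] M. Reed, B. Simon, *Methods of Modern Mathematical Physics I* (1980), Thm. II.3.
-/

set_option autoImplicit false
-- the mandated namespace repeats the single-problem summit's segment (`HodgeConjecture.HodgeConjecture`)
set_option linter.dupNamespace false

noncomputable section

open MeasureTheory Set
open scoped InnerProductSpace
open Literature.NumberTheory.Automorphic

namespace Summit.HodgeConjecture.HodgeConjecture.Cruxes.H413.K2E1ResidualEisExhaustionCMTwo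

universe u

/-! ## §1 Abstract Hilbert space -/

section Abstract

variable {H : Type*} [NormedAddCommGroup H] [InnerProductSpace ℂ H] {β : Type*}

/-- **(EXH) — JOINT INJECTIVITY ON `Eis`, NO ORTHOGONALITY, ANY INDEX**: subspaces `Blk b` with orthogonal projections, `Eis ≤ closure (⨆_b Blk b)`, linear `V b : H →ₗ X b` injective
on `Blk b`; then `x ∈ Eis` with `V b (P_{Blk b} x) = 0` for all `b` is `0` — `P_{Blk b} x = 0` puts `x` in `⨅_b (Blk b)ᗮ = (⨆_b Blk b)ᗮ = (closure ⨆_b Blk b)ᗮ`, hence `⟪x, x⟫ = 0`.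
[cite: MoeglinWaldspurger1995, II.2.4, V.3.13] [cite: ReedSimonI1980, Thm. II.3] -/
theorem exhaustion_injective_of_blocks (Blk : β → Submodule ℂ H) [∀ b, (Blk b).HasOrthogonalProjection]
    (Eis : Submodule ℂ H) (hEis : Eis ≤ (⨆ b, Blk b).topologicalClosure)
    {X : β → Type*} [∀ b, AddCommGroup (X b)] [∀ b, Module ℂ (X b)] (V : ∀ b, H →ₗ[ℂ] X b) (hV : ∀ b, ∀ y ∈ Blk b, V b y = 0 → y = 0) :
    ∀ x ∈ Eis, (∀ b, (V b ∘ₗ ((Blk b).starProjection : H →L[ℂ] H).toLinearMap) x = 0) → x = 0 := by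
  intro x hx h0
  have hb : ∀ b, x ∈ (Blk b)ᗮ := fun b =>
    ((Blk b).starProjection_apply_eq_zero_iff).1
      (hV b _ ((Blk b).starProjection_apply_mem x) (by simpa only [LinearMap.comp_apply, ContinuousLinearMap.coe_coe] using h0 b))
  have hx' : x ∈ ((⨆ b, Blk b).topologicalClosure)ᗮ := by
    rw [Submodule.orthogonal_closure, ← Submodule.iInf_orthogonal]
    exact (Submodule.mem_iInf _).2 hb
  exact inner_self_eq_zero.1 ((Submodule.mem_orthogonal _ x).1 hx' x (hEis hx))

end Abstract

/-! ## §2–§3 The `𝒢`-prints: the `hEXH` letter of ★ `hatoms_of_letters` ∕ ★ `hatoms_of_noLineMass` -/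

section Residual

variable {F : Type} [Field F] [NumberField F] (𝒢 : AdelicGroupData.{u} F) (μ : Measure 𝒢.automorphicQuotient)
variable {β : Type*} {A L : β → Type*} [∀ b, AddCommGroup (A b)] [∀ b, Module ℂ (A b)] [∀ b, AddCommGroup (L b)] [∀ b, Module ℂ (L b)]

/-- **(EXH) ON `L²(G(F)∖G(𝔸), μ)` WITHOUT ORTHOGONALITY** (ruling (261)): blocks `Blk b ≤ L²` with orthogonal projections (e.g. closed), `Eis ≤ closure ⨆_b Blk b`, and atom × line
coordinates `V b : L² →ₗ A b × L b` injective on `Blk b` (the D4′ isometries composed with nothing else); then `U b := V b ∘ P_{Blk b}` are jointly injective on `Eis` — the `hEXH`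
binder of ★ `hatoms_of_letters` ∕ ★ `hatoms_of_noLineMass` VERBATIM. [cite: MoeglinWaldspurger1995, II.2.4, V.3.13] -/
theorem hEXH_of_blocks (Blk : β → Submodule ℂ (𝒢.L2 μ)) [∀ b, (Blk b).HasOrthogonalProjection]
    (Eis : Submodule ℂ (𝒢.L2 μ)) (hEis : Eis ≤ (⨆ b, Blk b).topologicalClosure)
    (V : ∀ b, 𝒢.L2 μ →ₗ[ℂ] (A b × L b)) (hV : ∀ b, ∀ y ∈ Blk b, V b y = 0 → y = 0) :
    ∀ x ∈ Eis, (∀ b, (V b ∘ₗ ((Blk b).starProjection : 𝒢.L2 μ →L[ℂ] 𝒢.L2 μ).toLinearMap) x = 0) → x = 0 :=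
  exhaustion_injective_of_blocks Blk Eis hEis V hV

/-- **(EXH) AT THE C7 ADAPTER'S SHAPE** (dealer (260)): generating sets `gen s ⊆ L²` indexed by `s ∈ S` (the level-`K′` characters `↥S(K′)` and pseudo-Eisenstein families of ★
`exists_finite_blocks`; associates may both occur), `Eis ≤ closure ⨆_s closure span (gen s)` — the adapter's clause VERBATIM — and coordinates `V s : L² →ₗ A s × L s` injective on the
closed block `closure span (gen s)`; then `U s := V s ∘ P_{closure span (gen s)}` are jointly injective on `Eis`: the `hEXH` binder of ★ `hatoms_of_letters` VERBATIM.
[cite: MoeglinWaldspurger1995, II.1.4, II.2.4, V.3.13] -/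
theorem hEXH_of_generators {S : Type*} (gen : S → Set (𝒢.L2 μ))
    (Eis : Submodule ℂ (𝒢.L2 μ)) (hEis : Eis ≤ (⨆ s, (Submodule.span ℂ (gen s)).topologicalClosure).topologicalClosure)
    {A' L' : S → Type*} [∀ s, AddCommGroup (A' s)] [∀ s, Module ℂ (A' s)] [∀ s, AddCommGroup (L' s)] [∀ s, Module ℂ (L' s)]
    (V : ∀ s, 𝒢.L2 μ →ₗ[ℂ] (A' s × L' s)) (hV : ∀ s, ∀ y ∈ (Submodule.span ℂ (gen s)).topologicalClosure, V s y = 0 → y = 0) :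
    ∀ x ∈ Eis, (∀ s, (V s ∘ₗ (((Submodule.span ℂ (gen s)).topologicalClosure).starProjection : 𝒢.L2 μ →L[ℂ] 𝒢.L2 μ).toLinearMap) x = 0) → x = 0 :=
  exhaustion_injective_of_blocks (fun s => (Submodule.span ℂ (gen s)).topologicalClosure) Eis hEis V hV

end Residual

end Summit.HodgeConjecture.HodgeConjecture.Cruxes.H413.K2E1ResidualEisExhaustionCMTwo

end
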